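import Mathlib.Analysis.SpecialFunctions.Gamma.Digamma
import Mathlib.NumberTheory.ArithmeticFunction.VonMangoldt
import Literature.NumberTheory.LFunctions.SekatskiiGeneralizedBombieriLagarias
import HarnessLib

/-!
# Sekatskii's generalized Li criterion: the derivatives `(1/(n−1)!) dⁿ/dzⁿ[(z−a)^{n−1} log ξ(z)]|_{z=b}` (§§3–5)

LABEL (line 1): **RH-EQUIVALENT** — typed family of criteria "all derivatives
`(1/(n−1)!) dⁿ/dzⁿ[(z−a)^{n−1} log ξ(z)]|_{z=1−a}` are `≥ 0` (`a < ½`) / `≤ 0` (`a > ½`)", each of which IS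
the Riemann hypothesis (Theorem 5), the quasi-RH variant (Theorem 6), and the ARITHMETIC FORMULA for the
generalized Li sums `k_{n,a}`, `Re a > 1` (Theorem 7, RH-FREE identity, named fact).  bears_on:
LADDER-RH L-C/L-P (COLUMN 4, LI).  WHAT THIS IS NOT: moving the expansion point of Li's criterion from
`s = 1` to any real `b ≠ ½` re-indexes RH, it does not weaken it; for `a > 1` the prime sums in
Theorem 7 converge absolutely, but `k_{n,a} ≥ 0 ∀ n` is still RH (Theorem 1) and no finite set of `n`
says anything; nothing here bears on the truth of RH.

Source: S. K. Sekatskii, *Generalized Bombieri–Lagarias' theorem and generalized Li's criterion with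
its arithmetic interpretation*, Ukr. Math. J. **66** (2014) 415–431 [Sekatskii2014], §3 (Theorems 5, 6,
eq. (6)), §4 (Theorem 7, eq. (10)), §5 (Conclusions).  Locators `pNN` = pages of
`lit read paper:doi-10-1007-s11253-014-0940-9` (p01 = journal p. 415).  §2 (Theorems 1–3, the sums
`k_{n,a} = liSekatskiiSum a n`) is the sibling file `SekatskiiGeneralizedBombieriLagarias.lean`, on
which everything here rests.

## Dictionary (paper ↦ tree)

* `(1/(n−1)!) dⁿ/dzⁿ((z − a)^{n−1} ln ξ(z))|_{z=b}` ↦ `liSekatskiiDeriv a b n` (real part of the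
  complex derivative with the principal `log ∘ riemannXi`, exactly as the tree's `keiperLiCoeff`, which
  is the case `a = 0, b = 1`: `liSekatskiiDeriv_zero_one`).  `ξ > 0` on the real axis, so `log ξ` is
  holomorphic near every real `b` and the value does not depend on the branch; Sekatskii's `ξ` is the
  tree's `riemannXi` (p02 (2)).
* `Σ_ρ (1 − ((ρ − a)/(ρ + a − 2σ))ⁿ)` over the zeros of `ξ` with multiplicity, conjugates paired
  (pp. 424–425) ↦ `liSekatskiiSumAt a σ n` (absolutely convergent sum of real parts over the non-trivial
  zeros of `ζ`, as in the sibling file; `liSekatskiiSumAt a ½ n = liSekatskiiSum a n`).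
* `ψ` = digamma ↦ `Complex.digamma`; `Λ` ↦ `ArithmeticFunction.vonMangoldt`; the Hurwitz zeta value
  `ζ(j, a/2) = Σ_{m≥0} (m + a/2)^{−j}` (p14, integer `j ≥ 2`, real `a > 1`) is written as that series.

## Contents (source item ↦ declaration)

* `liSekatskiiDeriv`, `liSekatskiiDeriv_zero_one : liSekatskiiDeriv 0 1 n = keiperLiCoeff n` (p01 (1)).
* Eq. (6) (p. 423) and its general-`σ` form (pp. 424–425): NAMED FACT `Sekatskii2014_sum_eq_deriv`:
  `Σ_ρ m(ρ)Re(1 − ((ρ−a)/(ρ+a−2σ))ⁿ) = (2σ − 2a) · liSekatskiiDeriv a (2σ − a) n` (`n ≥ 1`).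
  **TYPING NOTE (print slip).** The journal text prints the coefficient of the derivative in (6) as
  `n(2a−1)/(n−1)!` (and `n(2σ−2a)/(n−1)!` on p. 425); the residue of `g̃(z) ln ξ(z)` at the pole of
  order `n+1` of `g̃` ((5), p. 422) carries `1/n!`, so the coefficient is `n(2a−1)/n! = (2a−1)/(n−1)!` —
  exactly as in the paper's own derivation of Li's (1) from (3)–(4) (p. 422, coefficient
  `1/(n−1)! = n/n!`), and as forced by the cases `a = 0, 1`, where the identity must reduce to
  `k_{n,0} = k_{n,1} = λ_n` (sibling file, `liSekatskiiSum_zero/_one`; with the printed extra factor `n`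
  it would read `λ_n = n λ_n`).  We type the corrected identity; Theorem 5 as printed is consistent
  with it and unaffected.  Independent check: under `z = a + (2σ−2a)s` the right-hand side is Li's
  coefficient of the entire function `s ↦ ξ(a + (2σ−2a)s)`, whose zeros `ρ′ = (ρ−a)/(2σ−2a)` have
  `(1 − 1/ρ′)⁻¹ = (ρ−a)/(ρ+a−2σ)`, and Li's/Bombieri–Lagarias' computation gives the left side.
* Thm 5 (p. 423): `sekatskii2014_thm5` — PROVED from the fact and Theorem 1 (sibling file): for
  `a < ½`, `RH ⟺ ∀ n ≥ 1, liSekatskiiDeriv a (1−a) n ≥ 0`; for `a > ½`, `… ≤ 0`.  §5 restatement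
  (p. 430: "for arbitrarily large `b > −½` all derivatives `(1/(n−1)!) dⁿ/dzⁿ((z+b)^{n−1} ln ξ(z))|_{z=b+1}`
  should be nonnegative"): `sekatskii2014_conclusion`.
* Thm 6 (p. 424): `sekatskii2014_thm6` — PROVED from the fact and Theorem 2 (sibling file): for
  `σ > ½`, "no non-trivial zeros with `Re ρ > σ`" ⟺ (all derivatives at `z = 2σ − a`, `a < σ`, are `≥ 0`)
  ∧ (all derivatives at `z = 2 − 2σ − a`, `a > 1 − σ`, are `≤ 0`).
* Thm 7 (p. 429, eq. (10)): NAMED FACT `Sekatskii2014_thm7` (`liSekatskiiSum a n = liSekatskiiArith a n`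
  for real `a > 1`, `n ≥ 1`; `-- TODO(general form): complex a, Re a > 1`), RH-FREE; with the PROVED
  corollary `riemannHypothesis_iff_liSekatskiiArith_nonneg` (Thm 1 + Thm 7: RH ⟺ positivity of an
  expression in absolutely convergent prime sums, Hurwitz zeta values and `ψ(a/2)`).

## Deliberately NOT here

Thm 4 (generalized Littlewood theorem — the contour tool); Lemma 1 (p. 425, the inverse Mellin
transform `g_{n,a}` of `1 − (1 − (2a−1)/(s+a−1))ⁿ`) and the Weil-explicit-formula bookkeeping (8)–(9),
(11) (proof steps of Thm 7); Remark 5 (the case `n = 1`: `Σ_ρ 1/(a−ρ) = 1/a + 1/(a−1) − Σ Λ(m)m^{−a}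
+ ½(ψ(a/2) − ln π)`, the classical partial-fraction formula for `ξ′/ξ`, cf. the tree's
`RiemannXiLogDeriv.lean`); Remarks 3–4 (other zeta-functions, conformal-map variant).

## References

* [Sekatskii2014] S. K. Sekatskii, Ukr. Math. J. 66 (2014) 415–431, §3 Thm 5 (p. 423), Thm 6 (p. 424),
  eq. (6) (p. 423); §4 Thm 7, eq. (10) (p. 429); §5 (p. 430).
* [Li1997] X.-J. Li, J. Number Theory 65 (1997), (1.1), (1.4).
* [BombieriLagarias1999] E. Bombieri, J. C. Lagarias, J. Number Theory 77 (1999), Thm 1, Thm 2.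
-/

noncomputable section

open Complex Filter Topology Set Finset
open scoped ComplexConjugate Nat

namespace Literature.NumberTheory.LFunctions

/-! ### The derivatives -/

/-- **Sekatskii's generalized Li derivative** `(1/(n−1)!) dⁿ/dzⁿ((z − a)^{n−1} ln ξ(z))|_{z=b}`
(p. 423, Thm 5 with `b = 1 − a`; p. 424, Thm 6 with `b = 2σ − a`, `2 − 2σ − a`; p. 430 with
`(a, b) = (−b′, b′+1)`), typed like the tree's `keiperLiCoeff` (principal `Complex.log ∘ riemannXi`,
holomorphic near the real point `b` where `ξ(b) > 0`; real part taken; at `n = 0` the `ℕ`-subtraction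
junk value `Re log ξ(b)`, only `n ≥ 1` is meaningful). [cite: Sekatskii2014, Thm 5 (p. 423)] -/
def liSekatskiiDeriv (a b : ℝ) (n : ℕ) : ℝ :=
  (iteratedDeriv n (fun z : ℂ ↦ (z - a) ^ (n - 1) * Complex.log (riemannXi z)) b / ((n - 1)! : ℂ)).re

/-- At `a = 0`, `b = 1` Sekatskii's derivative is Li's `λ_n` (the paper's (1), p. 415).
[cite: Sekatskii2014, eq. (1)] -/
theorem liSekatskiiDeriv_zero_one (n : ℕ) : liSekatskiiDeriv 0 1 n = keiperLiCoeff n := by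
  simp only [liSekatskiiDeriv, keiperLiCoeff, ofReal_zero, sub_zero, ofReal_one]

/-- **Sekatskii's sums at level `σ`**: `Σ_ρ (1 − ((ρ − a)/(ρ + a − 2σ))ⁿ)` over the zeros of `ξ` with
multiplicity (pp. 424–425, proof of Thm 6), typed as the absolutely convergent sum of real parts over the
non-trivial zeros of `ζ` (`Sekatskii.summable_term` with `Sekatskii.summable_weight_zetaZeros`).
`σ = ½` gives `k_{n,a}` (`liSekatskiiSumAt_half`). [cite: Sekatskii2014, Thm 6 (proof, pp. 424–425)] -/
def liSekatskiiSumAt (a σ : ℝ) (n : ℕ) : ℝ :=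
  ∑' ρ : ZetaZeros.riemannZetaNontrivialZeros,
    (riemannZetaZeroOrder (ρ : ℂ) : ℝ) * (1 - (((ρ : ℂ) - a) / ((ρ : ℂ) + a - 2 * σ)) ^ n).re

/-- `liSekatskiiSumAt a ½ n = k_{n,a}`. [cite: Sekatskii2014, Thm 1 and Thm 6] -/
theorem liSekatskiiSumAt_half (a : ℝ) (n : ℕ) : liSekatskiiSumAt a (1 / 2) n = liSekatskiiSum a n := by
  unfold liSekatskiiSumAt liSekatskiiSum
  refine tsum_congr fun ρ ↦ ?_
  have : (ρ : ℂ) + a - 2 * ((1 / 2 : ℝ) : ℂ) = (ρ : ℂ) + a - 1 := by push_cast; ring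
  rw [this]

namespace Sekatskii

/-- Multiplicity of a non-trivial zero as a natural number. [folklore] -/
private theorem toNat_cast_order' (ρ : ZetaZeros.riemannZetaNontrivialZeros) :
    (((riemannZetaZeroOrder (ρ : ℂ)).toNat : ℕ) : ℝ) = (riemannZetaZeroOrder (ρ : ℂ) : ℝ) := by
  have h := ZetaZeros.riemannZetaNontrivialZeros.one_le_order ρ.2
  have : ((riemannZetaZeroOrder (ρ : ℂ)).toNat : ℤ) = riemannZetaZeroOrder (ρ : ℂ) :=
    Int.toNat_of_nonneg (by omega)
  exact_mod_cast this

/-- The multiplicities are positive. [folklore] -/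
private theorem toNat_order_pos' (ρ : ZetaZeros.riemannZetaNontrivialZeros) :
    0 < (riemannZetaZeroOrder (ρ : ℂ)).toNat := by
  have := ZetaZeros.riemannZetaNontrivialZeros.one_le_order ρ.2; omega

/-- Hypothesis (i) of Theorem 2 is automatic for the (non-real) zeros of `ζ`. [folklore] -/
private theorem coe_ne_two_mul_sub' (ρ : ZetaZeros.riemannZetaNontrivialZeros) (a σ : ℝ) :
    (ρ : ℂ) ≠ 2 * σ - a := by
  intro h
  have him := ZetaZeros.riemannZetaNontrivialZeros.im_ne_zero ρ.2
  rw [h] at him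
  simp at him

/-- `liSekatskiiSumAt` is the family sum of Theorem 2 for the zeros of `ζ` with `ℕ`-valued
multiplicities. [folklore] -/
private theorem liSekatskiiSumAt_eq_tsum (a σ : ℝ) (n : ℕ) :
    liSekatskiiSumAt a σ n = ∑' ρ : ZetaZeros.riemannZetaNontrivialZeros,
      ((riemannZetaZeroOrder (ρ : ℂ)).toNat : ℝ) *
        (1 - (((ρ : ℂ) - a) / ((ρ : ℂ) + a - 2 * σ)) ^ n).re := by
  unfold liSekatskiiSumAt
  exact tsum_congr fun ρ ↦ by rw [toNat_cast_order']

/-- Theorem 2 (`a < σ`) for the zeros of `ζ` in terms of `liSekatskiiSumAt`.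
[cite: Sekatskii2014, Thm 2 and Thm 6 (proof)] -/
theorem forall_re_le_iff_sumAt_nonneg {a σ : ℝ} (haσ : a < σ) :
    (∀ ρ : ZetaZeros.riemannZetaNontrivialZeros, (ρ : ℂ).re ≤ σ) ↔
      ∀ n : ℕ, 1 ≤ n → 0 ≤ liSekatskiiSumAt a σ n := by
  simp only [liSekatskiiSumAt_eq_tsum]
  exact sekatskii2014_thm2_of_lt (fun ρ : ZetaZeros.riemannZetaNontrivialZeros ↦ (ρ : ℂ))
    (fun ρ ↦ (riemannZetaZeroOrder (ρ : ℂ)).toNat) haσ toNat_order_pos'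
    (fun ρ ↦ coe_ne_two_mul_sub' ρ a σ) (summable_weight_zetaZeros a σ)

/-- Theorem 2 (`a > σ`) for the zeros of `ζ` in terms of `liSekatskiiSumAt`.
[cite: Sekatskii2014, Thm 2 (a′) and Thm 6 (proof)] -/
theorem forall_le_re_iff_sumAt_nonneg {a σ : ℝ} (hσa : σ < a) :
    (∀ ρ : ZetaZeros.riemannZetaNontrivialZeros, σ ≤ (ρ : ℂ).re) ↔
      ∀ n : ℕ, 1 ≤ n → 0 ≤ liSekatskiiSumAt a σ n := by
  simp only [liSekatskiiSumAt_eq_tsum]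
  exact sekatskii2014_thm2_of_gt (fun ρ : ZetaZeros.riemannZetaNontrivialZeros ↦ (ρ : ℂ))
    (fun ρ ↦ (riemannZetaZeroOrder (ρ : ℂ)).toNat) hσa toNat_order_pos'
    (fun ρ ↦ coe_ne_two_mul_sub' ρ a σ) (summable_weight_zetaZeros a σ)

end Sekatskii

/-! ### Eq. (6): the sums as derivatives (named fact) -/

/-- **Sekatskii 2014, eq. (6) (p. 423) and its general-`σ` form (pp. 424–425)** — NAMED FACT, not proved
here.  Printed (6): `−[n(2a−1)/(n−1)!] dⁿ/dzⁿ((z−a)^{n−1} ln ξ(z))|_{z=1−a} + n(2a−1)(ξ′/ξ)(1−a)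
− Σ_ρ(1 − ((ρ−a)/(ρ+a−1))ⁿ) + n(2a−1)Σ_ρ 1/(ρ+a−1) = 0`, where by `ξ′/ξ(1−a) = −Σ_ρ 1/(ρ+a−1)` the
second and fourth terms cancel; p. 425: "the equality between the sums `Σ_ρ(1 − ((ρ−a)/(ρ−2σ+a))ⁿ)`
and the derivatives `[n(2σ−2a)/(n−1)!] dⁿ/dzⁿ((z−a)^{n−1} ln ξ(z))|_{z=2σ−a}`".  TYPED WITH THE
COEFFICIENT CORRECTED to `(2σ−2a)/(n−1)!` (print slip `n/(n−1)!` for `n/n!`, see the module docstring: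
the residue at the order-`(n+1)` pole of (5) carries `1/n!`, and `a ∈ {0, 1}`, `σ = ½` must give
`λ_n`): for all real `a, σ` and `n ≥ 1`,
`Σ_ρ m(ρ) Re(1 − ((ρ−a)/(ρ+a−2σ))ⁿ) = (2σ − 2a) · (1/(n−1)!) Re dⁿ/dzⁿ((z−a)^{n−1} ln ξ(z))|_{z=2σ−a}`
(both sides vanish at `a = σ`).  Discharge: the Hadamard product of `ξ` around the real point `2σ − a`
and the termwise identity `(1/(n−1)!) dⁿ/dsⁿ[s^{n−1} log(1 − s/ρ′)]|_{s=1} = 1 − (1 − 1/ρ′)^{−n}` after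
`z = a + (2σ−2a)s` (cf. the tree's `keiperLiCoeff_eq_zero_sum_holds`, the case `a = 0, σ = ½`).
[cite: Sekatskii2014, eq. (6) (p. 423) and pp. 424–425] -/
def Sekatskii2014_sum_eq_deriv : Prop :=
  ∀ a σ : ℝ, ∀ n : ℕ, 1 ≤ n →
    liSekatskiiSumAt a σ n = (2 * σ - 2 * a) * liSekatskiiDeriv a (2 * σ - a) n

/-- The `σ = ½` case of the identity: `k_{n,a} = (1 − 2a) · liSekatskiiDeriv a (1 − a) n`.
[cite: Sekatskii2014, eq. (6) (p. 423)] -/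
theorem liSekatskiiSum_eq_deriv (h : Sekatskii2014_sum_eq_deriv) (a : ℝ) {n : ℕ} (hn : 1 ≤ n) :
    liSekatskiiSum a n = (1 - 2 * a) * liSekatskiiDeriv a (1 - a) n := by
  have := h a (1 / 2) n hn
  rw [liSekatskiiSumAt_half] at this
  rw [this]
  norm_num

/-! ### Theorem 5 — RH via derivatives of `log ξ` at any real point `≠ ½` -/

/-- **Sekatskii 2014, Theorem 5** (p. 423): "The Riemann hypothesis is equivalent to the nonnegativity
of all derivatives `(1/(n−1)!) dⁿ/dzⁿ((z − a)^{n−1} ln ξ(z))|_{z=1−a}` for all nonnegative integers `n`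
and any real `a < ½`; hence, it is also equivalent to the nonpositivity of all [these] derivatives for
all nonnegative integers `n` and any real `a > ½`."  (Typed for `n ≥ 1`, the range in which
`(1/(n−1)!)` and Li's `λ_n` make sense; each fixed `a` gives an equivalence, as in Theorem 1.)
PROVED from Theorem 1 (`sekatskii2014_thm1`, sibling file) CONDITIONALLY on the identity
`Sekatskii2014_sum_eq_deriv` (eq. (6)): `k_{n,a} = (1−2a)·D` with `1 − 2a > 0` resp. `< 0`.  At
`a = 0` this is Li's criterion (`liSekatskiiDeriv_zero_one`). [cite: Sekatskii2014, Thm 5] -/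
theorem sekatskii2014_thm5 (h : Sekatskii2014_sum_eq_deriv) :
    (∀ a : ℝ, a < 1 / 2 →
      (RiemannHypothesis ↔ ∀ n : ℕ, 1 ≤ n → 0 ≤ liSekatskiiDeriv a (1 - a) n)) ∧
    (∀ a : ℝ, 1 / 2 < a →
      (RiemannHypothesis ↔ ∀ n : ℕ, 1 ≤ n → liSekatskiiDeriv a (1 - a) n ≤ 0)) := by
  constructor
  · intro a ha
    rw [sekatskii2014_thm1 ha.ne]
    refine forall_congr' fun n ↦ forall_congr' fun hn ↦ ?_
    rw [liSekatskiiSum_eq_deriv h a hn]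
    have h2 : 0 < 1 - 2 * a := by linarith
    constructor
    · intro h0; nlinarith
    · intro h0; positivity
  · intro a ha
    rw [sekatskii2014_thm1 ha.ne']
    refine forall_congr' fun n ↦ forall_congr' fun hn ↦ ?_
    rw [liSekatskiiSum_eq_deriv h a hn]
    have h2 : 1 - 2 * a < 0 := by linarith
    constructor
    · intro h0; nlinarith
    · intro h0; exact mul_nonneg_of_nonpos_of_nonpos h2.le h0

/-- **§5, Conclusions** (p. 430): "to judge the validity of the Riemann hypothesis, the evaluation of
certain derivatives of the Riemann xi-function can be used at any point of the real axis apart from the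
point `z = ½`.  In particular … for arbitrarily large numbers `b > −½`, all derivatives
`(1/(n−1)!) dⁿ/dzⁿ((z + b)^{n−1} ln ξ(z))|_{z=b+1}` should be nonnegative to guarantee that the RH is
true, and vice versa."  (Theorem 5 with `a = −b`.)  PROVED conditionally on `Sekatskii2014_sum_eq_deriv`.
[cite: Sekatskii2014, §5 (p. 430)] -/
theorem sekatskii2014_conclusion (h : Sekatskii2014_sum_eq_deriv) {b : ℝ} (hb : -1 / 2 < b) :
    RiemannHypothesis ↔ ∀ n : ℕ, 1 ≤ n → 0 ≤ liSekatskiiDeriv (-b) (b + 1) n := by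
  have := (sekatskii2014_thm5 h).1 (-b) (by linarith)
  rw [this]
  refine forall_congr' fun n ↦ forall_congr' fun _ ↦ ?_
  rw [show (1 : ℝ) - -b = b + 1 by ring]

/-! ### Theorem 6 — zero-free half-planes `Re ρ ≤ σ` via derivatives -/

/-- Zero-free `Re s > σ` passes to `Re s ≥ 1 − σ` by the reflection `ρ ↦ 1 − ρ̄`
("If there are no zeros with `Re ρ > σ > ½`, then there are no zeros with `Re ρ < 1 − σ`", p. 425).
[cite: Sekatskii2014, Thm 6 (proof, p. 425)] -/
theorem Sekatskii.forall_one_sub_le_re_of_forall_re_le {σ : ℝ}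
    (h : ∀ ρ : ZetaZeros.riemannZetaNontrivialZeros, (ρ : ℂ).re ≤ σ) :
    ∀ ρ : ZetaZeros.riemannZetaNontrivialZeros, 1 - σ ≤ (ρ : ℂ).re := by
  intro ρ
  have := h ⟨1 - conj (ρ : ℂ), ZetaZeros.riemannZetaNontrivialZeros.one_sub_conj_mem ρ.2⟩
  simp only [sub_re, one_re, conj_re] at this
  linarith

/-- **Sekatskii 2014, Theorem 6** (p. 424): "The statement that there are no nontrivial zeros of the
Riemann function with `Re ρ > σ > ½` is equivalent to the statement that, for any `a < σ`, all
derivatives `(1/(n−1)!) dⁿ/dzⁿ((z − a)^{n−1} ln ξ(z))|_{z=2σ−a}` are nonnegative and, for any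
`a > 1 − σ`, all derivatives `(1/(n−1)!) dⁿ/dzⁿ((z − a)^{n−1} ln ξ(z))|_{z=2−2σ−a}` are nonpositive."
("no nontrivial zeros with `Re ρ > σ`" ↦ every non-trivial zero has `Re ρ ≤ σ`; `n ≥ 1`.)  PROVED from
Theorem 2 (sibling file, both signs) CONDITIONALLY on the identity `Sekatskii2014_sum_eq_deriv`
(general `σ`), following the printed proof (pp. 424–425); the first family alone is already
equivalent (the `←` direction uses only it, with `a = σ − 1`), and the printed restriction `σ > ½` is
not used (the equivalence as typed holds for every real `σ`; at `σ = ½` it is Theorem 5).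
[cite: Sekatskii2014, Thm 6] -/
theorem sekatskii2014_thm6 (h : Sekatskii2014_sum_eq_deriv) (σ : ℝ) :
    (∀ ρ : ZetaZeros.riemannZetaNontrivialZeros, (ρ : ℂ).re ≤ σ) ↔
      ((∀ a : ℝ, a < σ → ∀ n : ℕ, 1 ≤ n → 0 ≤ liSekatskiiDeriv a (2 * σ - a) n) ∧
       (∀ a : ℝ, 1 - σ < a → ∀ n : ℕ, 1 ≤ n → liSekatskiiDeriv a (2 - 2 * σ - a) n ≤ 0)) := by
  constructor
  · intro hz
    constructor
    · intro a ha n hn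
      have hs := (Sekatskii.forall_re_le_iff_sumAt_nonneg ha).1 hz n hn
      rw [h a σ n hn] at hs
      have h2 : 0 < 2 * σ - 2 * a := by linarith
      nlinarith
    · intro a ha n hn
      have hz' := Sekatskii.forall_one_sub_le_re_of_forall_re_le hz
      have hs := (Sekatskii.forall_le_re_iff_sumAt_nonneg (σ := 1 - σ) (a := a) (by linarith)).1
        hz' n hn
      rw [h a (1 - σ) n hn] at hs
      have h2 : 2 * (1 - σ) - 2 * a < 0 := by linarith
      have heq : 2 * (1 - σ) - a = 2 - 2 * σ - a := by ring
      rw [heq] at hs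
      nlinarith
  · rintro ⟨h1, -⟩
    have ha : σ - 1 < σ := by linarith
    refine (Sekatskii.forall_re_le_iff_sumAt_nonneg ha).2 fun n hn ↦ ?_
    rw [h (σ - 1) σ n hn]
    have := h1 (σ - 1) ha n hn
    have h2 : 0 < 2 * σ - 2 * (σ - 1) := by linarith
    positivity

/-- Under `Sekatskii2014_sum_eq_deriv`, `σ = ½` is excluded from Theorem 6 only nominally: at `σ = ½`
the first family of conditions is Theorem 5's, and the statement is RH (`sekatskii2014_thm5`).  The
unconditional `σ = 1` instance: `ζ` has no zeros with `Re ρ > 1`, so for every `a < 1` and `n ≥ 1`,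
`liSekatskiiDeriv a (2 − a) n ≥ 0` — PROVED conditionally on the identity (an RH-FREE consequence).
[cite: Sekatskii2014, Thm 6 (case σ = 1)] -/
theorem liSekatskiiDeriv_nonneg_of_lt_one (h : Sekatskii2014_sum_eq_deriv) {a : ℝ} (ha : a < 1)
    {n : ℕ} (hn : 1 ≤ n) : 0 ≤ liSekatskiiDeriv a (2 - a) n := by
  have hz : ∀ ρ : ZetaZeros.riemannZetaNontrivialZeros, (ρ : ℂ).re ≤ 1 :=
    fun ρ ↦ (ZetaZeros.riemannZetaNontrivialZeros.re_lt_one ρ.2).le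
  have := ((sekatskii2014_thm6 h 1).1 hz).1 a ha n hn
  simpa [show (2 : ℝ) * 1 - a = 2 - a by ring] using this

/-! ### Theorem 7 — the arithmetic formula for `k_{n,a}`, `a > 1` (named fact) -/

/-- **The right-hand side of Sekatskii's arithmetic formula (10)** (p. 429), for real `a > 1` and `n ≥ 1`:
`2 − (−1 + 1/a)ⁿ − (−1 − 1/(a−1))ⁿ + Σ_{j=1}^{n} C(n,j)(2a−1)^j ((−1)^j/(j−1)!) Σ_{m≥1} Λ(m) ln^{j−1}m / m^a
+ (n/2)(2a−1)(ψ(a/2) − ln π) + Σ_{j=2}^{n} C(n,j)(−1)^j 2^{−j}(2a−1)^j ζ(j, a/2)`, with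
`ζ(j, a/2) = Σ_{m≥0} (m + a/2)^{−j}` the Hurwitz zeta value and `ψ` the digamma function (all series
absolutely convergent for `a > 1`; the `m = 0` term of the `Λ`-series is `0`).
[cite: Sekatskii2014, Thm 7, eq. (10)] -/
def liSekatskiiArith (a : ℝ) (n : ℕ) : ℝ :=
  2 - (-1 + 1 / a) ^ n - (-1 - 1 / (a - 1)) ^ n
    + (∑ j ∈ Icc 1 n, (n.choose j : ℝ) * (2 * a - 1) ^ j * ((-1) ^ j / ((j - 1)! : ℝ)) *
        ∑' m : ℕ, (ArithmeticFunction.vonMangoldt m : ℝ) * Real.log m ^ (j - 1) / (m : ℝ) ^ a)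
    + (n : ℝ) / 2 * (2 * a - 1) * ((Complex.digamma ((a / 2 : ℝ) : ℂ)).re - Real.log Real.pi)
    + ∑ j ∈ Icc 2 n, (n.choose j : ℝ) * (-1) ^ j * (2 * a - 1) ^ j / 2 ^ j *
        ∑' m : ℕ, 1 / ((m : ℝ) + a / 2) ^ j

/-- **Sekatskii 2014, Theorem 7** (p. 429) — NAMED FACT, RH-FREE (an identity obtained from Weil's
explicit formula applied to the inverse Mellin transform of `1 − (1 − (2a−1)/(s+a−1))ⁿ`, Lemma 1 and
(8)–(9)): "For `n = 1, 2, 3, …` and any complex `a` with `Re a > 1`, the following relation is true: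
`Σ_ρ(1 − ((ρ−a)/(ρ+a−1))ⁿ) = Σ_ρ(1 − ((ρ+a−1)/(ρ−a))ⁿ) = [liSekatskiiArith a n]` (10)."  Typed for REAL
`a > 1` (the sums `k_{n,a}` being typed as real-part sums); the first equality is the proved
`liSekatskiiSum_one_sub` of the sibling file.  The case `n = 1` is the classical
`Σ_ρ 1/(a−ρ) = 1/a + 1/(a−1) − Σ_m Λ(m)m^{−a} + ½(ψ(a/2) − ln π)` (Remark 5).
-- TODO(general form): complex `a` with `Re a > 1` (complex-valued sums).
[cite: Sekatskii2014, Thm 7, eq. (10)] -/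
def Sekatskii2014_thm7 : Prop :=
  ∀ a : ℝ, 1 < a → ∀ n : ℕ, 1 ≤ n → liSekatskiiSum a n = liSekatskiiArith a n

/-- **RH as positivity of an arithmetic expression** (Theorem 1 + Theorem 7): for any real `a > 1`,
CONDITIONALLY on the arithmetic formula `Sekatskii2014_thm7`,
`RH ⟺ ∀ n ≥ 1, liSekatskiiArith a n ≥ 0` — the generalized Li criterion "with its arithmetic
interpretation" (§4, p. 425: "an arithmetic interpretation of the generalized Li's criterion").  PROVED
from `sekatskii2014_thm1`.  WHAT THIS IS NOT: every series in `liSekatskiiArith a n` converges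
absolutely, but the binomial weights `C(n,j)(2a−1)^j` grow exponentially in `n`; positivity for all `n`
is RH itself. [cite: Sekatskii2014, Thm 1 and Thm 7 (§4)] -/
theorem riemannHypothesis_iff_liSekatskiiArith_nonneg (h7 : Sekatskii2014_thm7) {a : ℝ} (ha : 1 < a) :
    RiemannHypothesis ↔ ∀ n : ℕ, 1 ≤ n → 0 ≤ liSekatskiiArith a n := by
  rw [sekatskii2014_thm1 (a := a) (by linarith)]
  exact forall_congr' fun n ↦ forall_congr' fun hn ↦ by rw [h7 a ha n hn]

end Literature.NumberTheory.LFunctions
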